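import Literature.Computability.Complexity.PEASigmaTwoProgram
import Literature.Computability.Complexity.CodeFP
import Literature.Computability.Complexity.CodeFPArith
import Literature.Computability.Complexity.CodeFPLists
import Literature.Computability.Complexity.CodeFPStrings
import Literature.Computability.Complexity.CodeFPStringKit
import Literature.Computability.Complexity.CodeFPListKit
import Literature.Computability.Complexity.CodeFPBudgets
import Literature.Computability.Complexity.IrreducibilityLLLPrimeSearchFP
import Literature.Computability.QuantumComplexity.HidingProgramMachine
import HarnessLib

/-!
# Entropy approximation in `Σ₂ᵖ`, VII: the leaves of the program are polynomial time on codes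

Seventh file of the proof of `PEA d ∈ promiseLift (SigmaP 2)` (program: `PEASigmaTwoProgram.lean`).
In the typed `FP` algebra `CodeFP` (`CodeFP*.lean`) we assemble, in "environment-passing" style
(every lemma takes the `CodeFP` certificates of its arguments as functions of an arbitrary
environment `θ`), the leaves of the matrix `PEAHash.matCore`:

* unary arithmetic in environment form (`unMulE`, `unAddE`, `unSubE`, from the tree's
  `unMul_codeFP`, `unAdd`, `MachineA.unSub`) and loops over `LLLFactoring.urangeUn` (the range
  `[0, …, n-1]` of a UNARY bound with its items CODED IN UNARY, so that loop indices feed the unary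
  offsets of `CodeFP.slice` directly — all loop bounds and window offsets of the program are
  polynomial in the number `n'` of used variables, itself at most the length of the instance code);
* `sliceE` (`sliceD`), `dotBE` (`dotB`, by the brick `HashBricks.andParityFn`), `evalMapE`
  (`evalMono`/`evalPoly`/`evalMap`), `fibOKE`, `hashOKE`, `relOKE`, `notInXE`.

The parameters, the renaming and the matrix itself are assembled in `PEASigmaTwoFP.lean`.

## References

* S. Arora, B. Barak, *Computational Complexity: A Modern Approach*, CUP 2009, §1.3 (polynomial
  time is closed under composition and polynomially bounded loops).
* M. Sipser, STOC 1983, §V.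
-/

namespace Literature.Computability.Complexity

open _root_.Computability CodeFP

namespace PEAHash

variable {θ α : Type} {eθ : θ → List Bool} {eα : α → List Bool}

/-! ### Environment-passing forms of the list combinators -/

/-- `all` over a computed list with a body reading the environment. [cite: AroraBarak2009, §1.3] -/
theorem allE {fl : θ → List α} {p : θ × α → Bool} (hl : CodeFP eθ (rawE eα) fl) (hp : CodeFP (pairE eθ eα) bitE p) :
    CodeFP eθ bitE (fun x => (fl x).all fun a => p (x, a)) :=
  (all hp).comp ((CodeFP.id eθ).pair hl)

/-- `any` over a computed list with a body reading the environment. [cite: AroraBarak2009, §1.3] -/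
theorem anyE {fl : θ → List α} {p : θ × α → Bool} (hl : CodeFP eθ (rawE eα) fl) (hp : CodeFP (pairE eθ eα) bitE p) :
    CodeFP eθ bitE (fun x => (fl x).any fun a => p (x, a)) :=
  (any hp).comp ((CodeFP.id eθ).pair hl)

/-! ### Unary arithmetic -/

/-- Unary product of two computed unary numerals. [folklore] -/
theorem unMulE {f g : θ → ℕ} (hf : CodeFP eθ unE f) (hg : CodeFP eθ unE g) : CodeFP eθ unE (fun x => f x * g x) :=
  Literature.Computability.QuantumComplexity.unMul_codeFP.comp (hf.pair hg)

/-- Unary sum of two computed unary numerals. [folklore] -/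
theorem unAddE {f g : θ → ℕ} (hf : CodeFP eθ unE f) (hg : CodeFP eθ unE g) : CodeFP eθ unE (fun x => f x + g x) :=
  unAdd.comp (hf.pair hg)

/-- Unary difference of two computed unary numerals. [folklore] -/
theorem unSubE {f g : θ → ℕ} (hf : CodeFP eθ unE f) (hg : CodeFP eθ unE g) : CodeFP eθ unE (fun x => f x - g x) :=
  MachineA.unSub.comp (hf.pair hg)

/-- A unary constant. [folklore] -/
theorem unConstE (c : ℕ) : CodeFP eθ unE (fun _ => c) := const eθ c

/-! ### Windows and inner products -/

/-- **Windows**: `sliceD s off len` for computed `s` (string) and `off`, `len` (unary). [cite: AroraBarak2009, §1.3] -/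
theorem sliceE {fs : θ → List Bool} {fo fl : θ → ℕ} (hs : CodeFP eθ strE fs) (ho : CodeFP eθ unE fo) (hl : CodeFP eθ unE fl) :
    CodeFP eθ strE (fun x => sliceD (fs x) (fo x) (fl x)) :=
  (slice.comp (ho.pair (hl.pair hs))).congr fun _ => rfl

/-- An xor-fold is the parity of the number of `1`s. [folklore] -/
theorem foldl_xor_eq_decide_odd (l : List Bool) (b : Bool) :
    l.foldl (fun acc c => (acc ^^ c)) b = (b ^^ decide (Odd (l.count true))) := by
  induction l generalizing b with
  | nil => simp
  | cons c l ih =>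
    rw [List.foldl_cons, ih, List.count_cons]
    have hpar : decide (Odd (l.count true)) = !decide (Even (l.count true)) := by
      by_cases h : Even (l.count true)
      · simp [h, Nat.not_odd_iff_even.2 h]
      · simp [h, Nat.not_even_iff_odd.1 h]
    cases b <;> cases c <;> simp [Nat.odd_add_one, hpar]

/-- **The `F₂` inner product of two computed strings** (`HashBricks.andParityFn`). [cite: HanHemaspaandraThierauf1997, Def. 3.8] -/
theorem dotBE {fa fw : θ → List Bool} (ha : CodeFP eθ strE fa) (hw : CodeFP eθ strE fw) :
    CodeFP eθ bitE (fun x => dotB (fa x) (fw x)) := by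
  have h0 : CodeFP (pairE strE strE) bitE (fun p => dotB p.1 p.2) :=
    of_fn HashBricks.andParityFn HashBricks.andParityFn_mem_FP fun p => by
      rw [pairE_apply, HashBricks.andParityFn_boolPair]
      unfold dotB
      rw [foldl_xor_eq_decide_odd, Bool.false_xor]
      rfl
  exact h0.comp (ha.pair hw)

/-- A bit of a computed string at a computed unary position. [cite: AroraBarak2009, §1.3] -/
theorem getDE {fs : θ → List Bool} {fi : θ → ℕ} (hs : CodeFP eθ strE fs) (hi : CodeFP eθ unE fi) :
    CodeFP eθ bitE (fun x => (fs x).getD (fi x) false) :=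
  strGetD.comp (hi.pair hs)

/-! ### Evaluation of the sparse map -/

/-- `evalMono` on codes: context the point `xs`, item the monomial. [cite: DvirGutfreundRothblumVadhan2010, §2] -/
theorem evalMonoFP : CodeFP (pairE strE (rawE natE)) bitE (fun p => evalMono p.1 p.2) :=
  (all (p := fun q : List Bool × ℕ => q.1.getD q.2 false) strGetDNat).congr fun _ => rfl

/-- `evalPoly` on codes: context the point, an xor-fold over the monomials. [cite: DvirGutfreundRothblumVadhan2010, §2] -/
theorem evalPolyFP : CodeFP (pairE strE (rawE (rawE natE))) bitE (fun p => evalPoly p.1 p.2) := by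
  have hacc : CodeFP (pairE strE (pairE (rawE natE) bitE)) bitE (fun t => t.2.2) := (snd _ _).snd'
  have hmono : CodeFP (pairE strE (pairE (rawE natE) bitE)) bitE (fun t => evalMono t.1 t.2.1) :=
    evalMonoFP.comp ((fst _ _).pair (snd _ _).fst')
  have h := foldl (σ := List Bool) (α := List ℕ) (β := Bool) (eσ := strE) (eα := rawE natE) (eβ := bitE)
    (step := fun xs μ acc => (acc ^^ evalMono xs μ)) (init := fun _ => false)
    (hacc.xor hmono) (const strE false) 1 (fun _ _ _ => by simp [bitE])
  exact h.congr fun _ => rfl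

/-- **`evalMap` on codes** for a computed map and a computed point. [cite: DvirGutfreundRothblumVadhan2010, §2] -/
theorem evalMapE {fQ : θ → List (List (List ℕ))} {fxs : θ → List Bool} (hQ : CodeFP eθ (rawE (rawE (rawE natE))) fQ) (hxs : CodeFP eθ strE fxs) :
    CodeFP eθ (rawE bitE) (fun x => evalMap (fQ x) (fxs x)) :=
  ((map (g := fun q : List Bool × List (List ℕ) => evalPoly q.1 q.2) evalPolyFP).comp (hxs.pair hQ)).congr fun _ => rfl

/-! ### The relation and the refutation test -/

/-- **`fibOK` on codes**: the loop over the `T` blocks (unary `T`, `n'`). [cite: DvirGutfreundRothblumVadhan2010, §3 p.6] -/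
theorem fibOKE {fQ : θ → List (List (List ℕ))} {fn fT : θ → ℕ} {fx fw : θ → List Bool}
    (hQ : CodeFP eθ (rawE (rawE (rawE natE))) fQ) (hn : CodeFP eθ unE fn) (hT : CodeFP eθ unE fT) (hx : CodeFP eθ strE fx) (hw : CodeFP eθ strE fw) :
    CodeFP eθ bitE (fun x => fibOK (fQ x) (fn x) (fT x) (fx x) (fw x)) := by
  -- body on the environment `(x, i)`, `i` unary
  have hi : CodeFP (pairE eθ unE) unE (fun q => q.2) := snd _ _
  have hn' : CodeFP (pairE eθ unE) unE (fun q => fn q.1) := hn.comp (fst _ _)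
  have hoff : CodeFP (pairE eθ unE) unE (fun q => q.2 * fn q.1) := unMulE hi hn'
  have hQ' : CodeFP (pairE eθ unE) (rawE (rawE (rawE natE))) (fun q => fQ q.1) := hQ.comp (fst _ _)
  have h1 : CodeFP (pairE eθ unE) (rawE bitE) (fun q => evalMap (fQ q.1) (sliceD (fw q.1) (q.2 * fn q.1) (fn q.1))) :=
    evalMapE hQ' (sliceE (hw.comp (fst _ _)) hoff hn')
  have h2 : CodeFP (pairE eθ unE) (rawE bitE) (fun q => evalMap (fQ q.1) (sliceD (fx q.1) (q.2 * fn q.1) (fn q.1))) :=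
    evalMapE hQ' (sliceE (hx.comp (fst _ _)) hoff hn')
  have hbody : CodeFP (pairE eθ unE) bitE (fun q => evalMap (fQ q.1) (sliceD (fw q.1) (q.2 * fn q.1) (fn q.1)) ==
      evalMap (fQ q.1) (sliceD (fx q.1) (q.2 * fn q.1) (fn q.1))) :=
    (beq (rawE_injective bitE_injective)).comp (h1.pair h2)
  exact (allE (LLLFactoring.urangeUn.comp hT) hbody).congr fun _ => rfl

/-- **`hashOK` on codes**: the loop over the `r` rows (unary `N`, `r`). [cite: Sipser1983, §III] -/
theorem hashOKE {fN fr : θ → ℕ} {fs fw : θ → List Bool}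
    (hN : CodeFP eθ unE fN) (hr : CodeFP eθ unE fr) (hs : CodeFP eθ strE fs) (hw : CodeFP eθ strE fw) :
    CodeFP eθ bitE (fun x => hashOK (fN x) (fr x) (fs x) (fw x)) := by
  have hρ : CodeFP (pairE eθ unE) unE (fun q => q.2) := snd _ _
  have hN' : CodeFP (pairE eθ unE) unE (fun q => fN q.1) := hN.comp (fst _ _)
  have hr' : CodeFP (pairE eθ unE) unE (fun q => fr q.1) := hr.comp (fst _ _)
  have hs' : CodeFP (pairE eθ unE) strE (fun q => fs q.1) := hs.comp (fst _ _)
  have hoff : CodeFP (pairE eθ unE) unE (fun q => fN q.1 + q.2 * fN q.1) := unAddE hN' (unMulE hρ hN')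
  have hrow : CodeFP (pairE eθ unE) strE (fun q => sliceD (fs q.1) (fN q.1 + q.2 * fN q.1) (fN q.1)) := sliceE hs' hoff hN'
  have hdot : CodeFP (pairE eθ unE) bitE (fun q => dotB (sliceD (fs q.1) (fN q.1 + q.2 * fN q.1) (fN q.1)) (fw q.1)) :=
    dotBE hrow (hw.comp (fst _ _))
  have hpos : CodeFP (pairE eθ unE) unE (fun q => fN q.1 + fr q.1 * fN q.1 + q.2) := unAddE (unAddE hN' (unMulE hr' hN')) hρ
  have hbit : CodeFP (pairE eθ unE) bitE (fun q => (fs q.1).getD (fN q.1 + fr q.1 * fN q.1 + q.2) false) := getDE hs' hpos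
  have hbody : CodeFP (pairE eθ unE) bitE (fun q =>
      dotB (sliceD (fs q.1) (fN q.1 + q.2 * fN q.1) (fN q.1)) (fw q.1) == (fs q.1).getD (fN q.1 + fr q.1 * fN q.1 + q.2) false) :=
    (beq bitE_injective).comp (hdot.pair hbit)
  exact (allE (LLLFactoring.urangeUn.comp hr) hbody).congr fun _ => rfl

/-- **`relOK` on codes.** [cite: Sipser1983, §III] -/
theorem relOKE {fQ : θ → List (List (List ℕ))} {fn fT fN fr : θ → ℕ} {fs fw : θ → List Bool}
    (hQ : CodeFP eθ (rawE (rawE (rawE natE))) fQ) (hn : CodeFP eθ unE fn) (hT : CodeFP eθ unE fT) (hN : CodeFP eθ unE fN)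
    (hr : CodeFP eθ unE fr) (hs : CodeFP eθ strE fs) (hw : CodeFP eθ strE fw) :
    CodeFP eθ bitE (fun x => relOK (fQ x) (fn x) (fT x) (fN x) (fr x) (fs x) (fw x)) := by
  have hx : CodeFP eθ strE (fun x => sliceD (fs x) 0 (fN x)) := sliceE hs (unConstE 0) hN
  exact ((fibOKE hQ hn hT hx hw).and (hashOKE hN hr hs hw)).congr fun _ => rfl

/-- **`notInX` on codes**: the loop over the `t` blocks of a side vector, with the witness windows of
`u` for side number `c` (unary `c`). [cite: Sipser1983, §V] -/
theorem notInXE {fQ : θ → List (List (List ℕ))} {fn fT fN fr fM ft fc : θ → ℕ} {fside fu : θ → List Bool}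
    (hQ : CodeFP eθ (rawE (rawE (rawE natE))) fQ) (hn : CodeFP eθ unE fn) (hT : CodeFP eθ unE fT) (hN : CodeFP eθ unE fN)
    (hr : CodeFP eθ unE fr) (hM : CodeFP eθ unE fM) (ht : CodeFP eθ unE ft)
    (hside : CodeFP eθ strE fside) (hu : CodeFP eθ strE fu) (hc : CodeFP eθ unE fc) :
    CodeFP eθ bitE (fun x => notInX (fQ x) (fn x) (fT x) (fN x) (fr x) (fM x) (ft x) (fside x) (fu x) (fc x)) := by
  have hj : CodeFP (pairE eθ unE) unE (fun q => q.2) := snd _ _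
  have l {e : θ → List Bool} (h : CodeFP eθ strE e) : CodeFP (pairE eθ unE) strE (fun q => e q.1) := h.comp (fst _ _)
  have u {e : θ → ℕ} (h : CodeFP eθ unE e) : CodeFP (pairE eθ unE) unE (fun q => e q.1) := h.comp (fst _ _)
  have hblk : CodeFP (pairE eθ unE) strE (fun q => sliceD (fside q.1) (q.2 * fM q.1) (fM q.1)) :=
    sliceE (l hside) (unMulE hj (u hM)) (u hM)
  have hoff : CodeFP (pairE eθ unE) unE (fun q => (fc q.1 * ft q.1 + q.2) * fN q.1) :=
    unMulE (unAddE (unMulE (u hc) (u ht)) hj) (u hN)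
  have hwit : CodeFP (pairE eθ unE) strE (fun q => sliceD (fu q.1) ((fc q.1 * ft q.1 + q.2) * fN q.1) (fN q.1)) :=
    sliceE (l hu) hoff (u hN)
  have hrel : CodeFP (pairE eθ unE) bitE (fun q => relOK (fQ q.1) (fn q.1) (fT q.1) (fN q.1) (fr q.1)
      (sliceD (fside q.1) (q.2 * fM q.1) (fM q.1)) (sliceD (fu q.1) ((fc q.1 * ft q.1 + q.2) * fN q.1) (fN q.1))) :=
    relOKE (hQ.comp (fst _ _)) (u hn) (u hT) (u hN) (u hr) hblk hwit
  exact (anyE (LLLFactoring.urangeUn.comp ht) hrel.not).congr fun _ => rfl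

end PEAHash

end Literature.Computability.Complexity
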